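import Literature.AlgebraicGeometry.Pohlmann1968.DivisorClassesCMType
import Literature.AlgebraicGeometry.Pohlmann1968.HodgeClassesCMAlgebra
import HarnessLib

/-!
# The divisor part `Dᵖ ⊗ ℂ` of the Hodge ring of a PRODUCT of CM abelian varieties with different CM fields
# (CM algebra `E = ∏_i K_i`): Pohlmann's exceptional-class criterion in the general CM-algebra form

Companion of `Pohlmann1968/DivisorClassesCMType` (one CM type: `Dᵐ(A) ⊗ ℂ = ⊕_{Δ ∈ pohlmannDivisorSets Φ m}
H^{2m}(A)_Δ`, White's count, the criterion `exists_exceptional_iff`) and of `Pohlmann1968/HodgeClassesCMAlgebra`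
(Pohlmann's Theorem 1 for a general CM algebra `E = ∏_{i<n} K_i`, PROVED: `Pohlmann1968_thm1_cmAlgebra`).  The
same dictionary for the product `B = ⨁_i A_i` of realisations `(A_i, ι_i, θ_i)` of CM types `Φ_i` of possibly
DIFFERENT number fields `K_i` — the generality of Gao–Ullmo 2025, Thm. 3.1 ("CM pair `(E, Φ)`, `E` a CM algebra")
and the shape of the examples in which exceptional classes are usually exhibited (products such as
`B × E′ × E″`, cf. the tree's census `HodgeTheory/PohlmannSetsZeta24ProductSixfold`):

* `pohlmannDivisorSetsAlg Φ m` — the `2m`-subsets of `Hom(E, ℂ) = ⊔_i Hom(K_i, ℂ)` that are disjoint unions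
  of `m` balanced pairs (`pohlmannSetsAlg Φ 1`);
* `divisorClassesSpan_biproduct_eq_iSup` — `Dᵐ(B) ⊗ ℂ = ⊕ {H^{2m}(B)_S : S ∈ pohlmannDivisorSetsAlg Φ m}`;
* `finrank_divisorClassesSpan_biproduct_eq_ncard`, `pohlmannDivisorSetsAlg_subset_pohlmannSetsAlg`,
  `divisorClassesSpan_biproduct_le_hodgeClassSpan`;
* `finrank_hodgeClassSpan_sub_finrank_divisorClassesSpan_biproduct` — Gordon 9.2.2 / White's count:
  `dim Bᵐ(B) − dim Dᵐ(B) = #(pohlmannSetsAlg Φ m ∖ pohlmannDivisorSetsAlg Φ m)`;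
* `exists_exceptional_biproduct_iff` — `B` carries a rational `(m,m)`-class outside `Dᵐ ⊗ ℂ` iff some
  balanced `2m`-subset of `Hom(E, ℂ)` is not a disjoint union of balanced pairs.

Proofs: the abstract dictionary `divisorClassesSpan_eq_span_cupMonomial` of the one-type file, fed with the
eigenbasis `w_{(i,σ)} = π_i^* v_{i,σ}` of `H¹(B)` (`exists_eigenbasis`, `exists_biproductBasis_sigma`), the
eigen-line identification `H^d(B)_S = ℂ · w_S` (two distinct weights are separated by some
`a ∈ ∏_i 𝓞_{K_i}` supported on ONE factor: `NumberFields.exists_ringOfIntegers_prod_embeddings_ne`), and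
`Pohlmann1968_thm1_cmAlgebra` read in the monomial basis.  No named fact, no `sorry`.  Not here: existence
of the realisations (Riemann's theorem, the tree's undischarged `DeligneMilne1982_Thm_6_20_full`).

## References

* [Gordon1999HodgeAVSurvey] B. B. Gordon, *A survey of the Hodge conjecture for abelian varieties*, §9.2,
  9.2.2 Corollary ([B.138] = White 1993), §9.3.
* [GaoUllmo2025] Z. Gao, E. Ullmo, J. Inst. Math. Jussieu 25 (2025) 215–249, §2.1 and Thm. 3.1.
* [vanGeemen1994HodgeAV] B. van Geemen, LNM 1594 (1994), §2.4–2.5, Thm. 4.5, 4.7.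
* [Pohlmann1968] H. Pohlmann, Ann. of Math. (2) 88 (1968) 161–180, Thm. 1 and §3 (Mumford's example).
* [Milne2020HodgeClassesAV] J. S. Milne, *Hodge classes on abelian varieties* (2020), 1.2 (a)–(c).
-/

noncomputable section

open CategoryTheory CategoryTheory.Limits NumberField

namespace Literature.AlgebraicGeometry.Pohlmann1968

open Literature.AlgebraicTopology.SingularHomology
open Literature.AlgebraicGeometry.Motives (AbelianVariety CMType IsSmoothProjective ComplexPoints)
open Literature.AlgebraicGeometry.HodgeTheory
open Literature.AlgebraicGeometry.ComplexMultiplication (IsCMTypeRealisation)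
open Literature.AlgebraicGeometry.VanGeemen1994 (hodgeClassSpan)
open Literature.Barriers.HodgeConjecture (divisorMonomials divisorClassesSpan)
open Literature.NumberTheory.NumberFields (exists_ringOfIntegers_separating_embeddings
  exists_ringOfIntegers_prod_embeddings_ne)

section CMAlgebra

variable {n : ℕ} {K : Fin n → Type} [∀ i, Field (K i)]

/-- **Pohlmann divisor sets for the CM algebra `∏_i K_i`**: the `2m`-subsets of `⊔_i Hom(K_i, ℂ)` that are
disjoint unions of `m` balanced pairs (`pohlmannSetsAlg Φ 1`, indexing `B¹(B) ⊗ ℂ`) — the index set of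
`Dᵐ(B) ⊗ ℂ`. [cite: Gordon1999HodgeAVSurvey, 9.2.2] [cite: vanGeemen1994HodgeAV, §2.4] -/
def pohlmannDivisorSetsAlg (Φ : ∀ i, CMType (K i)) (m : ℕ) : Set (Finset ((i : Fin n) × (K i →+* ℂ))) :=
  disjointUnionsOf (pohlmannSetsAlg Φ 1) m

/-- Unfolding of `pohlmannDivisorSetsAlg`. [cite: Gordon1999HodgeAVSurvey, 9.2.2] -/
theorem pohlmannDivisorSetsAlg_def (Φ : ∀ i, CMType (K i)) (m : ℕ) :
    pohlmannDivisorSetsAlg Φ m = disjointUnionsOf (pohlmannSetsAlg Φ 1) m := rfl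

/-- Counting the members of a disjoint union with a property: the counts add. [folklore] -/
private theorem ncard_sep_disjUnion' {α : Type*} {s t : Finset α} (hst : Disjoint s t) (Q : α → Prop) :
    {x | x ∈ s.disjUnion t hst ∧ Q x}.ncard = {x | x ∈ s ∧ Q x}.ncard + {x | x ∈ t ∧ Q x}.ncard := by
  have hdisj : Disjoint {x | x ∈ s ∧ Q x} {x | x ∈ t ∧ Q x} :=
    Set.disjoint_left.mpr fun x hx hx' => Finset.disjoint_left.1 hst hx.1 hx'.1
  have hfin₁ : {x | x ∈ s ∧ Q x}.Finite := s.finite_toSet.subset fun x hx => hx.1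
  have hfin₂ : {x | x ∈ t ∧ Q x}.Finite := t.finite_toSet.subset fun x hx => hx.1
  rw [← Set.ncard_union_eq hdisj hfin₁ hfin₂]
  congr 1
  ext x
  simp only [Set.mem_setOf_eq, Set.mem_union, Finset.mem_disjUnion]
  tauto

/-- A disjoint union of balanced weights is balanced. [cite: GaoUllmo2025, Thm. 3.1 (3.2)] -/
theorem IsGaloisBalancedAlg.disjUnion {Φ : ∀ i, CMType (K i)} {s t : Finset ((i : Fin n) × (K i →+* ℂ))}
    (hs : IsGaloisBalancedAlg Φ s) (ht : IsGaloisBalancedAlg Φ t) (hst : Disjoint s t) :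
    IsGaloisBalancedAlg Φ (s.disjUnion t hst) := by
  intro τ
  rw [ncard_sep_disjUnion', ncard_sep_disjUnion', hs τ, ht τ]

/-- **Pohlmann divisor sets are Pohlmann sets** (general CM algebra): a disjoint union of `m` balanced pairs
is a balanced `2m`-set. [cite: Gordon1999HodgeAVSurvey, 9.2.2] -/
theorem pohlmannDivisorSetsAlg_subset_pohlmannSetsAlg (Φ : ∀ i, CMType (K i)) (m : ℕ) :
    pohlmannDivisorSetsAlg Φ m ⊆ pohlmannSetsAlg Φ m := by
  intro u hu
  refine ⟨card_of_mem_disjointUnionsOf (fun t ht => ht.1) hu, ?_⟩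
  exact disjointUnionsOf_induction (P := IsGaloisBalancedAlg Φ) (isGaloisBalancedAlg_empty Φ)
    (fun s t hs ht hst => hs.disjUnion ht.2 hst) hu

/-! #### Eigen-lines `H^d(B)_S = ℂ · w_S` for the product -/

/-- Common eigenvector of a diagonal family on the line of one basis vector, when every other index is
separated by some member of the family (private copy of the one-type file's helper). [folklore] -/
private theorem mem_span_singleton_of_forall_apply_eq_smul' {ι M R : Type*} [Fintype ι]
    [AddCommGroup M] [Module ℂ M] (b : Module.Basis ι ℂ M) (φ : R → (M →ₗ[ℂ] M)) (lam : R → ι → ℂ)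
    (hφ : ∀ r i, φ r (b i) = lam r i • b i) {i₀ : ι} (hsep : ∀ i, i ≠ i₀ → ∃ r, lam r i ≠ lam r i₀)
    {x : M} (hx : ∀ r, φ r x = lam r i₀ • x) : x ∈ ℂ ∙ b i₀ := by
  have hcoef : ∀ r i, b.repr x i * lam r i - lam r i₀ * b.repr x i = 0 := by
    intro r
    have hx' : ∑ i, (b.repr x i * lam r i - lam r i₀ * b.repr x i) • b i = 0 := by
      simp only [sub_smul, Finset.sum_sub_distrib, mul_smul]
      rw [sub_eq_zero]
      have h1 : φ r x = ∑ i, b.repr x i • lam r i • b i := by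
        conv_lhs => rw [← b.sum_repr x]
        simp only [map_sum, map_smul, hφ]
      have h2 : lam r i₀ • x = ∑ i, lam r i₀ • b.repr x i • b i := by
        conv_lhs => rw [← b.sum_repr x]
        rw [Finset.smul_sum]
      rw [← h1, ← h2, hx r]
    exact Fintype.linearIndependent_iff.1 b.linearIndependent _ hx'
  have hzero : ∀ i, i ≠ i₀ → b.repr x i = 0 := by
    intro i hi
    obtain ⟨r, hr⟩ := hsep i hi
    have h := hcoef r i
    rw [mul_comm (lam r i₀), ← mul_sub, mul_eq_zero] at h
    rcases h with h | h
    · exact h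
    · exact absurd (sub_eq_zero.1 h) hr
  rw [Submodule.mem_span_singleton]
  refine ⟨b.repr x i₀, ?_⟩
  conv_rhs => rw [← b.sum_repr x]
  rw [Finset.sum_eq_single i₀ (fun i _ hi => by rw [hzero i hi, zero_smul])
    (fun h => absurd (Finset.mem_univ i₀) h)]

variable [∀ i, NumberField (K i)]

/-- **Two distinct weights of `∏_i K_i` are separated by an integral element supported on one factor**: if
`S ≠ S'` are finite subsets of `⊔_i Hom(K_i, ℂ)`, some `a ∈ ∏_i 𝓞_{K_i}` (equal to `1` off one index `i₀`) has
`∏_{(i,σ) ∈ S} σ(a_i) ≠ ∏_{(i,σ) ∈ S'} σ(a_i)` (the one-field statement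
`NumberFields.exists_ringOfIntegers_prod_embeddings_ne` on the fibre where `S` and `S'` differ).
[cite: Milne2020HodgeClassesAV, 1.2 (a)] -/
theorem exists_prod_apply_ne_of_ne {S S' : Finset ((i : Fin n) × (K i →+* ℂ))} (h : S ≠ S') :
    ∃ a : ∀ i, 𝓞 (K i),
      ∏ x ∈ S, x.2 ((a x.1 : 𝓞 (K x.1)) : K x.1) ≠ ∏ x ∈ S', x.2 ((a x.1 : 𝓞 (K x.1)) : K x.1) := by
  classical
  have hinj : ∀ (i : Fin n) (T : Finset ((i : Fin n) × (K i →+* ℂ))),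
      Set.InjOn (Sigma.mk i) ((Sigma.mk i) ⁻¹' (T : Set ((i : Fin n) × (K i →+* ℂ)))) :=
    fun i T => sigma_mk_injective.injOn
  -- a fibre where the two sets differ
  obtain ⟨i₀, hi₀⟩ : ∃ i₀ : Fin n,
      S.preimage (Sigma.mk i₀) (hinj i₀ S) ≠ S'.preimage (Sigma.mk i₀) (hinj i₀ S') := by
    by_contra hall
    push Not at hall
    apply h
    ext ⟨i, σ⟩
    have := Finset.ext_iff.1 (hall i) σ
    simpa only [Finset.mem_preimage] using this
  obtain ⟨a₀, ha₀⟩ := exists_ringOfIntegers_prod_embeddings_ne hi₀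
  -- the family `a = (1, …, a₀, …, 1)` supported on the factor `i₀`
  let a : ∀ i, 𝓞 (K i) := fun i => if hi : i = i₀ then hi ▸ a₀ else 1
  have ha₀' : a i₀ = a₀ := by simp [a]
  have key : ∀ T : Finset ((i : Fin n) × (K i →+* ℂ)),
      ∏ x ∈ T, x.2 ((a x.1 : 𝓞 (K x.1)) : K x.1) =
        ∏ σ ∈ T.preimage (Sigma.mk i₀) (hinj i₀ T), σ (a₀ : K i₀) := by
    intro T
    rw [← Finset.prod_preimage (Sigma.mk i₀) T (hinj i₀ T)
      (fun x : (i : Fin n) × (K i →+* ℂ) => x.2 ((a x.1 : 𝓞 (K x.1)) : K x.1)) ?_]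
    · exact Finset.prod_congr rfl fun σ _ => by simp only [ha₀']
    · intro x _ hxr
      have hne : x.1 ≠ i₀ := by
        rintro rfl
        exact hxr ⟨x.2, rfl⟩
      simp only [a, dif_neg hne, map_one]
  refine ⟨a, ?_⟩
  rw [key, key]
  exact ha₀

variable {A : Fin n → AbelianVariety ℂ} {Φ : ∀ i, CMType (K i)} {ι : ∀ i, 𝓞 (K i) →+* End (A i)}
  {θ : ∀ i, K i →+* Module.End ℂ (complexBetti (A i).X 1)}

/-- **An eigenbasis of `H¹(⨁ A_i)` for `∏_i 𝓞_{K_i}`**, indexed by `⊔_i Hom(K_i, ℂ)`: `w_{(i,σ)} = π_i^* v_{i,σ}`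
with `(⊕_i ι_i(a_i))^* w_{(i,σ)} = σ(a_i) w_{(i,σ)}`, of Hodge type `(1,0)` for `σ ∈ Φ_i` and `(0,1)` otherwise
(`exists_eigenbasis` on each factor, `exists_biproductBasis_sigma`, `map_biproductMap_map_π`).
[cite: Milne2020HodgeClassesAV, 1.1–1.2 (a)] [cite: GaoUllmo2025, §2.1] -/
theorem exists_eigenbasis_biproduct (hA : ∀ i, IsCMTypeRealisation (Φ i) (A i) (ι i) (θ i)) :
    ∃ w : Module.Basis ((i : Fin n) × (K i →+* ℂ)) ℂ (complexBetti (⨁ A).X 1),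
      (∀ (c : ∀ i, 𝓞 (K i)) (x : (i : Fin n) × (K i →+* ℂ)),
        complexBetti.map (biproduct.map fun i => ι i (c i)).hom.hom.hom 1 (w x) =
          x.2 ((c x.1 : 𝓞 (K x.1)) : K x.1) • w x) ∧
      (∀ x : (i : Fin n) × (K i →+* ℂ), x.2 ∈ (Φ x.1).1 →
        IsOfHodgeType (⨁ A).dim (⨁ A).X 1 1 0 (w x)) ∧
      (∀ x : (i : Fin n) × (K i →+* ℂ), x.2 ∉ (Φ x.1).1 →
        IsOfHodgeType (⨁ A).dim (⨁ A).X 1 0 1 (w x)) := by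
  classical
  have hX : IsSmoothProjective (⨁ A).dim (⨁ A).X := Motives.AbelianVariety.isSmoothProjective_holds
  have hvex : ∀ i, ∃ v : Module.Basis (K i →+* ℂ) ℂ (complexBetti (A i).X 1),
      ∀ σ (c : K i), θ i c (v σ) = σ c • v σ := fun i => by
    obtain ⟨β, hβ⟩ := exists_ringOfIntegers_separating_embeddings (F := K i)
    exact exists_eigenbasis (hA i) hβ
  choose v hv using hvex
  obtain ⟨w, hw⟩ := exists_biproductBasis_sigma A v
  have hvl : ∀ i σ, v i σ ∈ Literature.NumberTheory.Automorphic.PicardCM.eigenline (θ i) σ := fun i σ =>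
    (Submodule.mem_iInf _).2 fun c => Module.End.mem_eigenspace_iff.2 (hv i σ c)
  have hθ : ∀ (i : Fin n) (c : 𝓞 (K i)) (σ : K i →+* ℂ),
      complexBetti.map (ι i c).hom.hom.hom 1 (v i σ) = σ (c : K i) • v i σ := fun i c σ => by
    rw [show complexBetti.map (ι i c).hom.hom.hom 1 (v i σ) =
      (complexBetti.map (ι i c).hom.hom.hom 1).hom (v i σ) from rfl, (hA i).2.2.1 c]
    exact hv i σ c
  refine ⟨w, fun c x => ?_, fun x hx => ?_, fun x hx => ?_⟩
  · rw [hw x, map_biproductMap_map_π, hθ, map_smul]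
  · rw [hw x]
    exact (((hA x.1).2.2.2 x.2).2.1 hx (v x.1 x.2) (hvl x.1 x.2)).map_of_isSmoothProjective hX
      (hA x.1).1 _
  · rw [hw x]
    exact (((hA x.1).2.2.2 x.2).2.2 hx (v x.1 x.2) (hvl x.1 x.2)).map_of_isSmoothProjective hX
      (hA x.1).1 _

/-- **`H^d(B)_S = ℂ · w_S`** for the product `B = ⨁ A_i`: the weight classes of weight `S` (`weightClassesAlg`:
`(⊕ ι_i(a_i))^* c = ∏_{(i,σ) ∈ S} σ(a_i) · c` for all `a ∈ ∏ 𝓞_{K_i}`) form the line of the cup monomial `w_S` on an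
eigenbasis `w`. [cite: Milne2020HodgeClassesAV, 1.2 (a)] [cite: GaoUllmo2025, Thm. 3.1] -/
theorem weightClassesAlg_eq_span_singleton [LinearOrder ((i : Fin n) × (K i →+* ℂ))]
    {w : Module.Basis ((i : Fin n) × (K i →+* ℂ)) ℂ (complexBetti (⨁ A).X 1)}
    (hw : ∀ (c : ∀ i, 𝓞 (K i)) (x : (i : Fin n) × (K i →+* ℂ)),
      complexBetti.map (biproduct.map fun i => ι i (c i)).hom.hom.hom 1 (w x) =
        x.2 ((c x.1 : 𝓞 (K x.1)) : K x.1) • w x)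
    {d : ℕ} {b : Module.Basis (Set.powersetCard ((i : Fin n) × (K i →+* ℂ)) d) ℂ (complexBetti (⨁ A).X d)}
    (hb : ∀ s, b s = cupMonomial w d s) (u : Set.powersetCard ((i : Fin n) × (K i →+* ℂ)) d) :
    weightClassesAlg A ι d (u : Finset ((i : Fin n) × (K i →+* ℂ))) = ℂ ∙ b u := by
  have hbu : ∀ (c : ∀ i, 𝓞 (K i)) (s : Set.powersetCard ((i : Fin n) × (K i →+* ℂ)) d),
      complexBetti.map (biproduct.map fun i => ι i (c i)).hom.hom.hom d (b s) =
        (∏ x ∈ (s : Finset ((i : Fin n) × (K i →+* ℂ))), x.2 ((c x.1 : 𝓞 (K x.1)) : K x.1)) • b s :=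
    fun c s => map_monomial_eq_prod_smul hb _ (hw c) s
  apply le_antisymm
  · intro c hc
    refine mem_span_singleton_of_forall_apply_eq_smul' b
      (fun a : ∀ i, 𝓞 (K i) => (complexBetti.map (biproduct.map fun i => ι i (a i)).hom.hom.hom d).hom)
      (fun a s => ∏ x ∈ (s : Finset ((i : Fin n) × (K i →+* ℂ))), x.2 ((a x.1 : 𝓞 (K x.1)) : K x.1)) hbu
      (fun s hs => ?_) (fun a => (mem_weightClassesAlg_iff.1 hc) a)
    have hne : (s : Finset ((i : Fin n) × (K i →+* ℂ))) ≠ (u : Finset ((i : Fin n) × (K i →+* ℂ))) :=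
      fun h => hs (Subtype.ext h)
    exact exists_prod_apply_ne_of_ne hne
  · rw [Submodule.span_singleton_le_iff_mem]
    exact mem_weightClassesAlg_iff.2 fun a => hbu a u

/-- `⊕_{S ∈ 𝒮} H^d(B)_S` is the span of the basis monomials `w_S`, `S ∈ 𝒮` (`𝒮` a set of `d`-subsets).
[cite: Milne2020HodgeClassesAV, 1.2 (a)] -/
theorem iSup_weightClassesAlg_eq_span_image [LinearOrder ((i : Fin n) × (K i →+* ℂ))]
    {w : Module.Basis ((i : Fin n) × (K i →+* ℂ)) ℂ (complexBetti (⨁ A).X 1)}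
    (hw : ∀ (c : ∀ i, 𝓞 (K i)) (x : (i : Fin n) × (K i →+* ℂ)),
      complexBetti.map (biproduct.map fun i => ι i (c i)).hom.hom.hom 1 (w x) =
        x.2 ((c x.1 : 𝓞 (K x.1)) : K x.1) • w x)
    {d : ℕ} {b : Module.Basis (Set.powersetCard ((i : Fin n) × (K i →+* ℂ)) d) ℂ (complexBetti (⨁ A).X d)}
    (hb : ∀ s, b s = cupMonomial w d s) {𝒮 : Set (Finset ((i : Fin n) × (K i →+* ℂ)))}
    (h𝒮 : ∀ S ∈ 𝒮, S.card = d) :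
    ⨆ S ∈ 𝒮, weightClassesAlg A ι d S = Submodule.span ℂ
      (b '' {u : Set.powersetCard ((i : Fin n) × (K i →+* ℂ)) d | (u : Finset ((i : Fin n) × (K i →+* ℂ))) ∈ 𝒮}) := by
  apply le_antisymm
  · refine iSup₂_le fun S hS => ?_
    rw [show S = ((Set.powersetCard.ofCard (h𝒮 S hS) : Set.powersetCard ((i : Fin n) × (K i →+* ℂ)) d) :
        Finset ((i : Fin n) × (K i →+* ℂ))) from rfl, weightClassesAlg_eq_span_singleton hw hb]
    exact Submodule.span_mono (Set.singleton_subset_iff.2 ⟨_, hS, rfl⟩)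
  · refine Submodule.span_le.2 ?_
    rintro _ ⟨u, hu, rfl⟩
    refine Submodule.mem_iSup_of_mem (u : Finset ((i : Fin n) × (K i →+* ℂ)))
      (Submodule.mem_iSup_of_mem hu ?_)
    rw [weightClassesAlg_eq_span_singleton hw hb u]
    exact Submodule.mem_span_singleton_self _

/-- **`Bᵐ(B) ⊗ ℂ` is the span of the balanced monomials** — `Pohlmann1968_thm1_cmAlgebra` in a monomial basis.
[cite: GaoUllmo2025, Thm. 3.1] [cite: Pohlmann1968, Thm. 1] -/
theorem hodgeClassSpan_biproduct_eq_span_image (hA : ∀ i, IsCMTypeRealisation (Φ i) (A i) (ι i) (θ i))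
    [LinearOrder ((i : Fin n) × (K i →+* ℂ))]
    {w : Module.Basis ((i : Fin n) × (K i →+* ℂ)) ℂ (complexBetti (⨁ A).X 1)}
    (hw : ∀ (c : ∀ i, 𝓞 (K i)) (x : (i : Fin n) × (K i →+* ℂ)),
      complexBetti.map (biproduct.map fun i => ι i (c i)).hom.hom.hom 1 (w x) =
        x.2 ((c x.1 : 𝓞 (K x.1)) : K x.1) • w x)
    {m : ℕ} {b : Module.Basis (Set.powersetCard ((i : Fin n) × (K i →+* ℂ)) (2 * m)) ℂ
      (complexBetti (⨁ A).X (2 * m))}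
    (hb : ∀ s, b s = cupMonomial w (2 * m) s) :
    hodgeClassSpan (⨁ A).dim (⨁ A).X m = Submodule.span ℂ
      (b '' {u : Set.powersetCard ((i : Fin n) × (K i →+* ℂ)) (2 * m) |
        (u : Finset ((i : Fin n) × (K i →+* ℂ))) ∈ pohlmannSetsAlg Φ m}) := by
  rw [(Pohlmann1968_thm1_cmAlgebra K A Φ ι θ hA m).1]
  exact iSup_weightClassesAlg_eq_span_image hw hb fun S hS => hS.1

/-- `B¹(B) ⊗ ℂ` in the cup-monomial form consumed by the abstract dictionary. [cite: GaoUllmo2025, Thm. 3.1] -/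
private theorem hodgeClassSpan_biproduct_one_eq (hA : ∀ i, IsCMTypeRealisation (Φ i) (A i) (ι i) (θ i))
    [LinearOrder ((i : Fin n) × (K i →+* ℂ))]
    {w : Module.Basis ((i : Fin n) × (K i →+* ℂ)) ℂ (complexBetti (⨁ A).X 1)}
    (hw : ∀ (c : ∀ i, 𝓞 (K i)) (x : (i : Fin n) × (K i →+* ℂ)),
      complexBetti.map (biproduct.map fun i => ι i (c i)).hom.hom.hom 1 (w x) =
        x.2 ((c x.1 : 𝓞 (K x.1)) : K x.1) • w x) :
    hodgeClassSpan (⨁ A).dim (⨁ A).X 1 = Submodule.span ℂ (cupMonomial w 2 ''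
      {t : Set.powersetCard ((i : Fin n) × (K i →+* ℂ)) 2 |
        (t : Finset ((i : Fin n) × (K i →+* ℂ))) ∈ pohlmannSetsAlg Φ 1}) := by
  obtain ⟨b₂, hb₂⟩ := exists_monomialBasis w 2
  rw [hodgeClassSpan_biproduct_eq_span_image hA hw (m := 1) hb₂]
  exact congrArg _ (Set.image_congr' hb₂)

/-- **The divisor ring of a product of CM abelian varieties (general CM algebra `E = ∏_i K_i`) in Pohlmann's
eigen-decomposition**: `Dᵐ(B) ⊗ ℂ = ⊕ {H^{2m}(B)_S : S ∈ pohlmannDivisorSetsAlg Φ m}`, the sum of the weight lines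
over the `2m`-subsets of `⊔_i Hom(K_i, ℂ)` that are disjoint unions of `m` balanced pairs.
[cite: Gordon1999HodgeAVSurvey, 9.2.2] [cite: vanGeemen1994HodgeAV, §2.4] [cite: GaoUllmo2025, Thm. 3.1] -/
theorem divisorClassesSpan_biproduct_eq_iSup (hA : ∀ i, IsCMTypeRealisation (Φ i) (A i) (ι i) (θ i)) (m : ℕ) :
    divisorClassesSpan (⨁ A).X (⨁ A).dim m =
      ⨆ S ∈ pohlmannDivisorSetsAlg Φ m, weightClassesAlg A ι (2 * m) S := by
  classical
  letI : LinearOrder ((i : Fin n) × (K i →+* ℂ)) :=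
    LinearOrder.lift' (Fintype.equivFin _) (Fintype.equivFin _).injective
  obtain ⟨w, hw, -, -⟩ := exists_eigenbasis_biproduct hA
  obtain ⟨b, hb⟩ := exists_monomialBasis w (2 * m)
  have hT : ∀ t ∈ pohlmannSetsAlg Φ 1, t.card = 2 := fun t ht => ht.1
  rw [pohlmannDivisorSetsAlg_def,
    divisorClassesSpan_eq_span_image_basis w hT (hodgeClassSpan_biproduct_one_eq hA hw) m hb,
    iSup_weightClassesAlg_eq_span_image hw hb fun S hS => card_of_mem_disjointUnionsOf hT hS]

/-- **`dim_ℂ (Dᵐ(B) ⊗ ℂ) = #pohlmannDivisorSetsAlg Φ m`.** [cite: Gordon1999HodgeAVSurvey, 9.2.2] -/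
theorem finrank_divisorClassesSpan_biproduct_eq_ncard
    (hA : ∀ i, IsCMTypeRealisation (Φ i) (A i) (ι i) (θ i)) (m : ℕ) :
    Module.finrank ℂ ↥(divisorClassesSpan (⨁ A).X (⨁ A).dim m) = (pohlmannDivisorSetsAlg Φ m).ncard := by
  classical
  letI : LinearOrder ((i : Fin n) × (K i →+* ℂ)) :=
    LinearOrder.lift' (Fintype.equivFin _) (Fintype.equivFin _).injective
  obtain ⟨w, hw, -, -⟩ := exists_eigenbasis_biproduct hA
  obtain ⟨b, hb⟩ := exists_monomialBasis w (2 * m)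
  have hT : ∀ t ∈ pohlmannSetsAlg Φ 1, t.card = 2 := fun t ht => ht.1
  rw [pohlmannDivisorSetsAlg_def]
  exact finrank_divisorClassesSpan_eq_ncard_disjointUnionsOf w hT (hodgeClassSpan_biproduct_one_eq hA hw) m hb

/-- `Dᵐ(B) ⊗ ℂ ⊆ Bᵐ(B) ⊗ ℂ`. [cite: vanGeemen1994HodgeAV, §2.4] -/
theorem divisorClassesSpan_biproduct_le_hodgeClassSpan
    (hA : ∀ i, IsCMTypeRealisation (Φ i) (A i) (ι i) (θ i)) (m : ℕ) :
    divisorClassesSpan (⨁ A).X (⨁ A).dim m ≤ hodgeClassSpan (⨁ A).dim (⨁ A).X m := by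
  rw [divisorClassesSpan_biproduct_eq_iSup hA m, (Pohlmann1968_thm1_cmAlgebra K A Φ ι θ hA m).1]
  exact iSup₂_le fun S hS => le_iSup₂_of_le S (pohlmannDivisorSetsAlg_subset_pohlmannSetsAlg Φ m hS) le_rfl

/-- **Gordon 9.2.2 / White's count for a product with a general CM algebra**: `dim Bᵐ(B) − dim Dᵐ(B)` is the
number of balanced `2m`-subsets of `⊔_i Hom(K_i, ℂ)` that are not disjoint unions of balanced pairs.
[cite: Gordon1999HodgeAVSurvey, 9.2.2] [cite: GaoUllmo2025, Thm. 3.1] -/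
theorem finrank_hodgeClassSpan_sub_finrank_divisorClassesSpan_biproduct
    (hA : ∀ i, IsCMTypeRealisation (Φ i) (A i) (ι i) (θ i)) (m : ℕ) :
    Module.finrank ℂ ↥(hodgeClassSpan (⨁ A).dim (⨁ A).X m) -
        Module.finrank ℂ ↥(divisorClassesSpan (⨁ A).X (⨁ A).dim m) =
      (pohlmannSetsAlg Φ m \ pohlmannDivisorSetsAlg Φ m).ncard := by
  rw [(Pohlmann1968_thm1_cmAlgebra K A Φ ι θ hA m).2, finrank_divisorClassesSpan_biproduct_eq_ncard hA m,
    Set.ncard_sdiff (pohlmannDivisorSetsAlg_subset_pohlmannSetsAlg Φ m)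
      ((Set.toFinite _).subset (pohlmannDivisorSetsAlg_subset_pohlmannSetsAlg Φ m))]

/-- **Pohlmann's criterion for exceptional Hodge classes on a product of CM abelian varieties with different
CM fields**: `B = ⨁_i A_i` carries a rational `(m,m)`-class OUTSIDE `Dᵐ ⊗ ℂ` (the formal content of the barrier
facts `Weil1977_exceptionalHodgeClasses` / `Mumford1968_simpleFourfold_exceptionalHodgeClasses` on a given
abelian variety) iff some balanced `2m`-subset of `Hom(∏_i K_i, ℂ)` is not a disjoint union of balanced pairs.
[cite: Gordon1999HodgeAVSurvey, 9.2.2 and §9.3] [cite: vanGeemen1994HodgeAV, §2.5 and Thm. 4.5]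
[cite: GaoUllmo2025, Thm. 3.1] -/
theorem exists_exceptional_biproduct_iff (hA : ∀ i, IsCMTypeRealisation (Φ i) (A i) (ι i) (θ i)) (m : ℕ) :
    (∃ c : complexBetti (⨁ A).X (2 * m), IsRationalClass c ∧
        IsOfHodgeType (⨁ A).dim (⨁ A).X (2 * m) m m c ∧ c ∉ divisorClassesSpan (⨁ A).X (⨁ A).dim m) ↔
      (pohlmannSetsAlg Φ m \ pohlmannDivisorSetsAlg Φ m).Nonempty := by
  classical
  constructor
  · rintro ⟨c, hcQ, hcH, hcD⟩
    by_contra hempty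
    rw [Set.not_nonempty_iff_eq_empty, Set.sdiff_eq_empty] at hempty
    apply hcD
    have hle : hodgeClassSpan (⨁ A).dim (⨁ A).X m ≤ divisorClassesSpan (⨁ A).X (⨁ A).dim m := by
      rw [divisorClassesSpan_biproduct_eq_iSup hA m, (Pohlmann1968_thm1_cmAlgebra K A Φ ι θ hA m).1]
      exact iSup₂_le fun S hS => le_iSup₂_of_le S (hempty hS) le_rfl
    exact hle (Submodule.subset_span ⟨hcQ, hcH⟩)
  · rintro ⟨S, hSP, hSD⟩
    letI : LinearOrder ((i : Fin n) × (K i →+* ℂ)) :=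
      LinearOrder.lift' (Fintype.equivFin _) (Fintype.equivFin _).injective
    obtain ⟨w, hw, -, -⟩ := exists_eigenbasis_biproduct hA
    obtain ⟨b, hb⟩ := exists_monomialBasis w (2 * m)
    have hT : ∀ t ∈ pohlmannSetsAlg Φ 1, t.card = 2 := fun t ht => ht.1
    let u : Set.powersetCard ((i : Fin n) × (K i →+* ℂ)) (2 * m) := Set.powersetCard.ofCard hSP.1
    have huB : b u ∈ hodgeClassSpan (⨁ A).dim (⨁ A).X m := by
      rw [hodgeClassSpan_biproduct_eq_span_image hA hw hb]
      exact Submodule.subset_span ⟨u, hSP, rfl⟩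
    have huD : b u ∉ divisorClassesSpan (⨁ A).X (⨁ A).dim m := by
      rw [show b u = cupMonomial w (2 * m) u from hb u,
        cupMonomial_mem_divisorClassesSpan_iff w hT (hodgeClassSpan_biproduct_one_eq hA hw) hb u,
        ← pohlmannDivisorSetsAlg_def]
      exact hSD
    by_contra hall
    push Not at hall
    have hle : hodgeClassSpan (⨁ A).dim (⨁ A).X m ≤ divisorClassesSpan (⨁ A).X (⨁ A).dim m :=
      Submodule.span_le.2 fun c hc => hall c hc.1 hc.2
    exact huD (hle huB)

end CMAlgebra

end Literature.AlgebraicGeometry.Pohlmann1968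

end
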